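import Summits.PneNP.PneNP.Theorems.SymmetryBudgetHamCompilesIface
import Summits.PneNP.PneNP.Theorems.SymmetryBudgetHamCompilesStubResidueNPCheck

/-!
# The untyped verifier against the residual predicate (line `kotzig-cutspan`, stub `stub_residueNP`)

Crux `Summit.PneNP.PneNP.Theses.SymmetryBudget.HamCompiles` (stmt-PneNP-10637), line
`kotzig-cutspan`, stub `stub_residueNP` (`ResidueLang ∈ NP`). The tests of the untyped verifier
`ResNP.check` (`…StubResidueNPCheck.lean`) are compared with the typed objects of the line
(`…SymmetryBudgetHamCompilesIface.lean`): this file reads the interface string at the explicit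
layout (`bit_encode`, values of `iIdxEquiv`; decoding `vOf`), relates typed certificates
`(d, PA, S₀)` to untyped ones (`untypeQ`, `List.ofFn d`, the binary number of `S₀`), and proves
the equivalences for the margin test, the path-cover tests, the label test and the slot test
(registered sub-goal `stub_residueNP_layout`; the parity test is in `…StubResidueNP.lean`).
-/

-- `Summit.PneNP.PneNP.…` duplicates `PneNP` BY DESIGN (single-problem summit, D-0017).
set_option linter.dupNamespace false

noncomputable section

namespace Summit.PneNP.PneNP.Theorems.HamCompilesKC

open Literature.Computability.Complexity
open Finset

namespace ResNP

/-! ### The layout: values of the index bijections -/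

/-- The binary number of a bit vector. -/
abbrev bv {n : ℕ} (S : Fin n → Bool) : ℕ := (boolVecEquiv n S : ℕ)

/-- `bv S < 2^n`. -/
theorem bv_lt {n : ℕ} (S : Fin n → Bool) : bv S < 2 ^ n := (boolVecEquiv n S).isLt

/-- `boolVecEquiv` is `finFunctionFinEquiv` on `0/1` digits. -/
theorem boolVecEquiv_apply {n : ℕ} (S : Fin n → Bool) :
    boolVecEquiv n S = finFunctionFinEquiv (fun i => finTwoEquiv.symm (S i)) := rfl

/-- The value of a `0/1` digit. -/
theorem finTwoEquiv_symm_val (b : Bool) : ((finTwoEquiv.symm b : Fin 2) : ℕ) = if b then 1 else 0 := by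
  cases b <;> rfl

/-- **Binary digits of `bv S`**: digit `i` is `[S i]`. -/
theorem bv_div_mod {n : ℕ} (S : Fin n → Bool) (i : Fin n) :
    bv S / 2 ^ (i : ℕ) % 2 = if S i then 1 else 0 := by
  have h := finFunctionFinEquiv_symm_apply_val (boolVecEquiv n S) i
  rw [boolVecEquiv_apply, Equiv.symm_apply_apply, finTwoEquiv_symm_val] at h
  rw [← boolVecEquiv_apply] at h
  exact h.symm

/-- `bv S` as a sum of powers of two. -/
theorem bv_eq_sum {n : ℕ} (S : Fin n → Bool) : bv S = ∑ i : Fin n, (if S i then 1 else 0) * 2 ^ (i : ℕ) := by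
  rw [bv, boolVecEquiv_apply, finFunctionFinEquiv_apply]
  exact Finset.sum_congr rfl fun i _ => by rw [finTwoEquiv_symm_val]

/-- The number of `(boolVecEquiv n).symm k` is `k`. -/
theorem bv_symm {n : ℕ} (k : Fin (2 ^ n)) : bv ((boolVecEquiv n).symm k) = k := by
  simp [bv]

variable {m : ℕ}

/-- Value of `iIdxEquiv`, at the literal sum type of `finSumFinEquiv` (the target `Fin (ell m)` is
that type up to unfolding `ell`). -/
theorem iIdxEquiv_val (i : IIdx m) :
    ((iIdxEquiv m i) : ℕ) = (finSumFinEquiv (Equiv.sumCongr (aIdxEquiv m) (fIdxEquiv m) i) :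
      Fin ((m * m + gOf m * m) + 2 ^ (3 * gOf m) * (2 ^ gOf m * 2 ^ gOf m))) := rfl

/-- Position of an A-block bit. -/
theorem iIdxEquiv_inl_inl (u v : Fin m) :
    ((iIdxEquiv m (Sum.inl (Sum.inl (u, v)))) : ℕ) = v + m * u := by
  rw [iIdxEquiv_val]
  simp [aIdxEquiv]

/-- Position of a class-table bit. -/
theorem iIdxEquiv_inl_inr (i : Fin (gOf m)) (a : Fin m) :
    ((iIdxEquiv m (Sum.inl (Sum.inr (i, a)))) : ℕ) = m * m + (a + m * i) := by
  rw [iIdxEquiv_val]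
  simp [aIdxEquiv]

/-- Position of an F-block bit. -/
theorem iIdxEquiv_inr (w : Fin (3 * gOf m) → Bool) (S₀ S : Fin (gOf m) → Bool) :
    ((iIdxEquiv m (Sum.inr (w, S₀, S))) : ℕ) =
      (m * m + gOf m * m) + ((bv S + 2 ^ gOf m * bv S₀) + (2 ^ gOf m * 2 ^ gOf m) * bv w) := by
  rw [iIdxEquiv_val]
  simp [fIdxEquiv, bv]

/-! ### Reading the interface string -/

/-- `|encode m v| = ell m`. -/
theorem length_encode' (v : IIdx m → Bool) : (encode m v).length = ell m := by unfold encode; simp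

/-- **The bit of `encode m v` at the position of index `i` is `v i`.** -/
theorem bit_encode (v : IIdx m → Bool) (i : IIdx m) : bit (encode m v) (iIdxEquiv m i) = v i := by
  unfold bit encode
  rw [List.getD_eq_getElem _ _ (by simp), List.getElem_ofFn]
  simp

/-- The A-block bit. -/
theorem abit_encode (v : IIdx m → Bool) (u w : Fin m) :
    abit (encode m v) m u w = v (Sum.inl (Sum.inl (u, w))) := by
  rw [← bit_encode v, iIdxEquiv_inl_inl]; rfl

/-- The class-table bit. -/
theorem nbit_encode (v : IIdx m → Bool) (i : Fin (gOf m)) (a : Fin m) :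
    nbit (encode m v) m i a = v (Sum.inl (Sum.inr (i, a))) := by
  rw [← bit_encode v, iIdxEquiv_inl_inr]; rfl

/-- The F-block bit. -/
theorem fbit_encode (v : IIdx m → Bool) (w : Fin (3 * gOf m) → Bool) (S₀ S : Fin (gOf m) → Bool) :
    fbit (encode m v) m (gOf m) (bv w) (bv S₀) (bv S) = v (Sum.inr (w, S₀, S)) := by
  rw [← bit_encode v, iIdxEquiv_inr]; rfl

/-- The bit assignment read off a string of length `ell m`. -/
def vOf (s : List Bool) (m : ℕ) : IIdx m → Bool := fun i => bit s (iIdxEquiv m i)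

/-- **A string of length `ell m` is the interface string of the assignment read off it.** -/
theorem encode_vOf {s : List Bool} (hs : s.length = ell m) : encode m (vOf s m) = s := by
  apply List.ext_getElem (by rw [length_encode', hs])
  intro j h1 h2
  unfold encode
  rw [List.getElem_ofFn]
  simp only [vOf, bit, Equiv.apply_symm_apply]
  rw [List.getD_eq_getElem _ _ h2]

/-- `Sum.elim` of the two blocks of an assignment is the assignment. -/
theorem sum_elim_vOf (s : List Bool) (m : ℕ) :
    Sum.elim (fun a => vOf s m (Sum.inl a)) (fun f => vOf s m (Sum.inr f)) = vOf s m := by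
  ext i; cases i <;> rfl

/-! ### Typed and untyped certificates -/

variable {g : ℕ}

/-- The untyped form of a labelled path: vertex numbers and label numbers. -/
def untypeQ (q : VSeq (Fin m) × (Fin g × Fin g)) : List ℕ × ℕ × ℕ :=
  (q.1.verts.map Fin.val, (q.2.1 : ℕ), (q.2.2 : ℕ))

/-- Untyped labelled paths have the right shape. -/
theorem itemOK_untypeQ (q : VSeq (Fin m) × (Fin g × Fin g)) : itemOK m g (untypeQ q) = true := by
  simp [itemOK, untypeQ, VSeq.verts]

/-- Untyped labelled path families have the right shape. -/
theorem shapeOK_map_untypeQ (PA : List (VSeq (Fin m) × (Fin g × Fin g))) :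
    shapeOK m g (PA.map untypeQ) = true := by
  simp [shapeOK, itemOK_untypeQ]

/-- **Every well-shaped untyped family is the untyped form of a typed one.** -/
theorem exists_eq_map_untypeQ : ∀ {PAL : List (List ℕ × ℕ × ℕ)}, shapeOK m g PAL = true →
    ∃ PA : List (VSeq (Fin m) × (Fin g × Fin g)), PAL = PA.map untypeQ
  | [], _ => ⟨[], rfl⟩
  | (l, a, b) :: PAL, h => by
    simp only [shapeOK, List.all_cons, Bool.and_eq_true] at h
    obtain ⟨hq, hrest⟩ := h
    obtain ⟨PA, hPA⟩ := exists_eq_map_untypeQ (PAL := PAL) hrest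
    simp only [itemOK, Bool.and_eq_true, Bool.not_eq_true', List.all_eq_true, decide_eq_true_eq] at hq
    obtain ⟨⟨⟨hne, hl⟩, ha⟩, hb⟩ := hq
    obtain ⟨v, l', rfl⟩ := List.exists_cons_of_ne_nil (List.isEmpty_eq_false_iff.1 hne)
    refine ⟨((⟨v, hl v (by simp)⟩, l'.pmap Fin.mk fun w hw => hl w (by simp [hw])), (⟨a, ha⟩, ⟨b, hb⟩)) :: PA,
      ?_⟩
    rw [List.map_cons, hPA]
    congr 1
    simp [untypeQ, VSeq.verts, List.map_pmap]

/-- Every list of `g` numbers is `List.ofFn` of a margin vector. -/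
theorem exists_eq_ofFn {dL : List ℕ} (h : dL.length = g) : ∃ d : Fin g → ℕ, dL = List.ofFn d := by
  subst h
  exact ⟨fun i => dL[(i : ℕ)], List.ofFn_getElem.symm⟩

/-- Entries of `List.ofFn d`. -/
@[simp] theorem getD_ofFn (d : Fin g → ℕ) (i : Fin g) : (List.ofFn d).getD i 0 = d i := by
  rw [List.getD_eq_getElem _ _ (by simp)]
  simp

/-- Every number below `2^g` is the number of a bit vector. -/
theorem exists_eq_bv {s0 : ℕ} (h : s0 < 2 ^ g) : ∃ S₀ : Fin g → Bool, s0 = bv S₀ :=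
  ⟨(boolVecEquiv g).symm ⟨s0, h⟩, by rw [bv_symm]⟩

/-- **The margin test.** -/
theorem dOK_ofFn (d : Fin g → ℕ) : dOK g (List.ofFn d) = true ↔ ∑ t, d t ≤ 2 * g := by
  simp [dOK, List.sum_ofFn]

/-! ### The path-cover tests -/

/-- The typed list of all listed vertices. -/
abbrev tverts (PA : List (VSeq (Fin m) × (Fin g × Fin g))) : List (Fin m) :=
  ((PA.map Prod.fst).map VSeq.verts).flatten

/-- The untyped vertices are the numbers of the typed ones. -/
theorem verts_map_untypeQ (PA : List (VSeq (Fin m) × (Fin g × Fin g))) :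
    verts (PA.map untypeQ) = (tverts PA).map Fin.val := by
  simp [verts, tverts, untypeQ, List.map_flatten, Function.comp_def]

/-- `chainB` decides `List.IsChain`. -/
theorem chainB_eq_true_iff {R : ℕ → ℕ → Bool} :
    ∀ {l : List ℕ}, chainB R l = true ↔ List.IsChain (fun a b => R a b = true) l
  | [] => by simp [chainB]
  | [a] => by simp [chainB]
  | a :: b :: l => by
    have ih := chainB_eq_true_iff (R := R) (l := b :: l)
    simp only [chainB, List.tail_cons, List.zipWith_cons_cons, List.all_cons, Bool.and_eq_true] at ih ⊢
    rw [ih, List.isChain_cons_cons]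

/-- The adjacency test reads the A-block graph. -/
theorem adjB_encode_iff (ab : AIdx m → Bool) (fb : FIdx m → Bool) (u v : Fin m) :
    adjB (encode m (Sum.elim ab fb)) m u v = true ↔
      (SimpleGraph.fromRel fun u v : Fin m => ab (Sum.inl (u, v)) = true).Adj u v := by
  rw [SimpleGraph.fromRel_adj, adjB, abit_encode, abit_encode]
  simp [Fin.ext_iff]

/-- **The chain test** is the path condition of `IsCoverOf`. -/
theorem chainsOK_iff (ab : AIdx m → Bool) (fb : FIdx m → Bool) (PA : List (VSeq (Fin m) × (Fin g × Fin g))) :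
    chainsOK (encode m (Sum.elim ab fb)) m (PA.map untypeQ) = true ↔
      ∀ p ∈ PA.map Prod.fst,
        List.IsChain (SimpleGraph.fromRel fun u v : Fin m => ab (Sum.inl (u, v)) = true).Adj p.verts := by
  simp only [chainsOK, List.all_map, List.all_eq_true, Function.comp_apply, List.forall_mem_map]
  refine forall₂_congr fun q _ => ?_
  rw [show (untypeQ q).1 = q.1.verts.map Fin.val from rfl, chainB_eq_true_iff, List.isChain_map]
  simp only [adjB_encode_iff]

/-- The cap of the cover loop is inactive. -/
theorem min_sub_eq {cap : ℕ} (hcap : m ≤ cap) : min (m - g) cap = m - g := min_eq_left (by omega)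

/-- **The exhaustiveness test**: the listed vertices are exactly the anchored ones. -/
theorem toFinset_eq_iff {cap : ℕ} (hcap : m ≤ cap) (PA : List (VSeq (Fin m) × (Fin (gOf m) × Fin (gOf m)))) :
    (tverts PA).toFinset = (freeSet m)ᶜ ↔
      ((verts (PA.map untypeQ)).all (fun v => decide (v + gOf m < m)) = true ∧
        (List.range (min (m - gOf m) cap)).all (fun v => decide (v ∈ verts (PA.map untypeQ))) = true) := by
  rw [min_sub_eq hcap, verts_map_untypeQ]
  simp only [List.all_eq_true, decide_eq_true_eq, List.mem_map, List.mem_range, forall_exists_index, and_imp,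
    forall_apply_eq_imp_iff₂]
  constructor
  · intro h
    have hmem : ∀ w : Fin m, w ∈ tverts PA ↔ (w : ℕ) + gOf m < m := fun w => by
      have := congrArg (w ∈ ·) h
      simpa [freeSet, IsAnch] using this
    refine ⟨fun w hw => (hmem w).1 hw, fun v hv => ⟨⟨v, by omega⟩, (hmem _).2 (by simp; omega), rfl⟩⟩
  · rintro ⟨h1, h2⟩
    ext w
    simp only [List.mem_toFinset, Finset.mem_compl, freeSet, Finset.mem_filter, Finset.mem_univ, true_and,
      not_not, IsAnch]
    constructor
    · exact h1 w
    · intro hw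
      obtain ⟨w', hw', he⟩ := h2 w (by omega)
      rwa [← Fin.ext he]

/-- **The path-cover tests** decide `IsCoverOf` of the anchored block. -/
theorem isCoverOf_iff {cap : ℕ} (hcap : m ≤ cap) (ab : AIdx m → Bool) (fb : FIdx m → Bool)
    (PA : List (VSeq (Fin m) × (Fin (gOf m) × Fin (gOf m)))) :
    IsCoverOf (SimpleGraph.fromRel fun u v : Fin m => ab (Sum.inl (u, v)) = true) (freeSet m)ᶜ (PA.map Prod.fst) ↔
      (coverOK m (gOf m) cap (PA.map untypeQ) = true ∧
        chainsOK (encode m (Sum.elim ab fb)) m (PA.map untypeQ) = true) := by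
  rw [IsCoverOf, toFinset_eq_iff hcap PA, ← chainsOK_iff ab fb PA]
  have hn : (tverts PA).Nodup ↔ (verts (PA.map untypeQ)).Nodup := by
    rw [verts_map_untypeQ, List.nodup_map_iff Fin.val_injective]
  rw [show ((PA.map Prod.fst).map VSeq.verts).flatten = tverts PA from rfl, hn]
  simp only [coverOK, Bool.and_eq_true, decide_eq_true_iff, and_assoc]

/-! ### The label test and the slot test -/

/-- The first untyped vertex. -/
theorem headD_untypeQ (q : VSeq (Fin m) × (Fin g × Fin g)) : (untypeQ q).1.headD 0 = (q.1.first : ℕ) := rfl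

/-- The last untyped vertex. -/
theorem lastD_untypeQ (q : VSeq (Fin m) × (Fin g × Fin g)) : lastD (untypeQ q).1 = (q.1.last : ℕ) := by
  rw [VSeq.last, List.getLast_eq_getElem, lastD, List.getD_eq_getElem _ _ (by simp [untypeQ, VSeq.verts])]
  simp only [untypeQ, VSeq.verts, List.getElem_map, List.length_map]

/-- **The label test.** -/
theorem labelsOK_iff (ab : AIdx m → Bool) (fb : FIdx m → Bool)
    (PA : List (VSeq (Fin m) × (Fin (gOf m) × Fin (gOf m)))) :
    labelsOK (encode m (Sum.elim ab fb)) m (PA.map untypeQ) = true ↔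
      ∀ q ∈ PA, ab (Sum.inr (q.2.1, q.1.first)) = true ∧ ab (Sum.inr (q.2.2, q.1.last)) = true := by
  simp only [labelsOK, List.all_map, List.all_eq_true, Function.comp_apply, Bool.and_eq_true]
  refine forall₂_congr fun q _ => ?_
  rw [headD_untypeQ, lastD_untypeQ, show (untypeQ q).2.1 = (q.2.1 : ℕ) from rfl,
    show (untypeQ q).2.2 = (q.2.2 : ℕ) from rfl, nbit_encode, nbit_encode]
  rfl

/-- Counting a label among untyped labels. -/
theorem count_map_untypeQ (PA : List (VSeq (Fin m) × (Fin g × Fin g))) (i : Fin g) :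
    ((PA.map untypeQ).map fun q => q.2.1).count (i : ℕ) = PA.countP fun q => decide (q.2.1 = i) := by
  rw [List.map_map, List.count_eq_countP, List.countP_map]
  exact List.countP_congr fun q _ => by simp [untypeQ, Fin.ext_iff]

/-- Counting a label among untyped labels. -/
theorem count_map_untypeQ' (PA : List (VSeq (Fin m) × (Fin g × Fin g))) (i : Fin g) :
    ((PA.map untypeQ).map fun q => q.2.2).count (i : ℕ) = PA.countP fun q => decide (q.2.2 = i) := by
  rw [List.map_map, List.count_eq_countP, List.countP_map]
  exact List.countP_congr fun q _ => by simp [untypeQ, Fin.ext_iff]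

/-- **The slot test.** -/
theorem slotsOK_iff (d : Fin g → ℕ) (PA : List (VSeq (Fin m) × (Fin g × Fin g))) :
    slotsOK g (List.ofFn d) (PA.map untypeQ) = true ↔ ∀ i, aSlots PA i = d i := by
  simp only [slotsOK, List.all_eq_true, List.mem_range, decide_eq_true_eq]
  rw [Fin.forall_iff]
  refine forall₂_congr fun i hi => ?_
  rw [count_map_untypeQ PA ⟨i, hi⟩, count_map_untypeQ' PA ⟨i, hi⟩, getD_ofFn d ⟨i, hi⟩]
  rfl

/-! ### Digits of the number of a cut -/

/-- Digit `i < g` of `bv S` in the digit list. -/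
theorem getD_bitsLE_bv (S : Fin g → Bool) {i : ℕ} (hi : i < g) :
    (bitsLE g (bv S)).getD i 0 = if S ⟨i, hi⟩ then 1 else 0 := by
  rw [bitsLE, List.getD_eq_getElem _ _ (by simpa using hi), List.getElem_map, List.getElem_range,
    min_eq_left hi.le]
  exact bv_div_mod S ⟨i, hi⟩

/-- Digit `i < g` of `bv S` is `1` iff `S i`. -/
theorem bitsLE_eq_one_iff (S : Fin g → Bool) {i : ℕ} (hi : i < g) :
    (bitsLE g (bv S)).getD i 0 = 1 ↔ S ⟨i, hi⟩ = true := by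
  rw [getD_bitsLE_bv S hi]; cases S ⟨i, hi⟩ <;> simp

/-- Digit `i` of `bv S`, decided, is `S i`. -/
theorem decide_bitsLE (S : Fin g → Bool) (i : Fin g) : decide ((bitsLE g (bv S)).getD i 0 = 1) = S i := by
  rw [Bool.eq_iff_iff, decide_eq_true_iff, bitsLE_eq_one_iff S i.isLt]

/-- List sums over `List.range` are `Finset.range` sums. -/
theorem sum_map_range {M : Type*} [AddCommMonoid M] (f : ℕ → M) :
    ∀ k : ℕ, ((List.range k).map f).sum = ∑ t ∈ Finset.range k, f t
  | 0 => by simp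
  | k + 1 => by
    rw [List.range_succ, List.map_append, List.sum_append, Finset.sum_range_succ, sum_map_range f k]
    simp

end ResNP

/-- Registered sub-goal of `stub_residueNP` served by this file: the interface string read at the
explicit layout. -/
theorem stub_residueNP_layout : ∀ (m : ℕ) (v : IIdx m → Bool) (i : IIdx m), ResNP.vOf (encode m v) m i = v i :=
  fun _ v i => ResNP.bit_encode v i


end Summit.PneNP.PneNP.Theorems.HamCompilesKC
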